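import Literature.NumberTheory.EllipticCurves.EichlerShimuraPeriodsGamma1EpsConjProofs
import Literature.NumberTheory.EllipticCurves.EichlerShimuraPeriodsGamma1CuspMomentsProofs
import Literature.NumberTheory.EllipticCurves.DeligneSerreProp27RealLatticeProofs
import Literature.NumberTheory.EllipticCurves.ModularSymbolsHeckeProofs
import Literature.NumberTheory.EllipticCurves.CuspFormTwist
import Literature.NumberTheory.EllipticCurves.LSeriesHeckeRecursionNonvanishingProofs
import Literature.NumberTheory.EllipticCurves.DirichletCharacterPrimitiveExistsProofs
import HarnessLib

/-!
# The Eichler–Shimura period lattice of `S_k(Γ₁(N))` spans the dual space over `ℝ` (`k ≥ 7`)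

For `f ∈ S_{n+2}(Γ₁(N))` let `Λ = periodLatticeK1 n ⊆ S_{n+2}(Γ₁(N))^∨` be the Eichler–Shimura
period lattice of `Literature.NumberTheory.EllipticCurves.EichlerShimuraPeriodsGamma1` (generated by
the periods `f ↦ ∫ f(z)(zv - u)ⁿ dz` over `{∞, σ∞}`, `σ ∈ Γ₀(N)`, `(u, v) ∈ ℤ²`; finitely generated,
stable under all `T_p^∨` and `⟨d⟩^∨`, separating).  Shimura 1971, (3.5.20) asks for a *full*
Hecke-stable lattice (the hypothesis structure `HeckeStableRealLattice N k` of
`DeligneSerreProp27RealLatticeProofs`, from which the tree derives Shimura's Thm. 3.48 (2),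
Thm. 3.52, Deligne–Serre (2.7.2) `DeligneSerre1974_span_integralLattice1` and Deligne–Serre
Prop. 5.5).  Fullness of `Λ` is the Eichler–Shimura isomorphism (Shimura Thm. 8.4,
`S_k ≅ H¹_P(Γ, ℝ)` as real vector spaces) and has two halves: **(i)** `Λ` spans `S^∨` over `ℝ` —
equivalently the *real* Eichler–Shimura map `f ↦ (re φ(f))_{φ ∈ Λ}` is injective — and **(ii)** `Λ`
is generated by `2 dim_ℂ S` elements (the rank count `dim_ℝ H¹_P = 2 dim_ℂ S_k`).

This file **proves (i) for all levels `N` and all weights `k = n + 2 ≥ 7`**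
(`periodLatticeK1_span_real_eq_top`), and the glue **(ii) ⇒ `HeckeStableRealLattice N (n + 2)`**
(`heckeStableRealLatticeOfGenerators`).  Classically (i) is proved with Petersson's scalar product
via Stokes' theorem on a fundamental domain (Shimura §8.2) or Haberland's formula; the proof here
is different and uses only holomorphic and arithmetic information:

1. (`EichlerShimuraPeriodsGamma1EpsConjProofs`) The real-part kernel
   `K = {f | re φ(f) = 0 ∀ φ ∈ Λ}` is a real subspace stable under Shimura's `ε` (`f ↦ \overline{f(-z̄)}`),
   under all `T_p` and `⟨d⟩`, with `K ∩ iK = 0`; on the complex spans of `K^± = {f ∈ K | f^ε = ±f}`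
   the periods satisfy the reflection identity `λ_{σ,q}(g) = ±(-1)ⁿ λ_{σ^ε,(-u,v)}(g)`.
2. (`EichlerShimuraPeriodsGamma1CuspMomentsProofs` and §B) Writing the periods as limits of
   integrals from the cusp `σ∞ = a/c` and extracting moments (Vandermonde), the reflection identity
   becomes, for the absolutely convergent integrals from the cusps,
   `∫₀^∞ g(a/c + it)(it)ʲ dt = ±(-1)^{n}(-1)^{n-j} ∫₀^∞ g(-a/c + it)(it)ʲ dt` (`n/2 < j ≤ n`).
3. (§C) If `ℂK^±` were non-zero it would contain a normalised simultaneous eigenform `g` of all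
   `T_p` (including `U_p`, `p ∣ N`) and `⟨d⟩` (commuting operators on a stable finite-dimensional
   space); its coefficients satisfy the Hecke recursions, so the twisted `L`-series
   `L(g ⊗ χ, s) = ∑ χ(m) aₘ m^{-s}` does not vanish for `re s > k/2 + 1`
   (`LSeriesHeckeRecursionNonvanishingProofs`: sieve out the small primes; no Euler product or
   Ramanujan bound is needed).
4. (§A, §D) For a primitive `χ` modulo `c = N²` (`DirichletCharacterPrimitiveExistsProofs`) the
   cusps `u/c`, `u ∈ (ℤ/c)ˣ`, are `Γ₀(N)`-equivalent to `∞`, and by Hecke's Mellin formula for the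
   translates `g(u/c + ·)` and the Gauss-sum identity `∑_u χ⁻¹(u) e(um/c) = χ(m) τ(χ⁻¹)`,
   `S_j = ∑_u χ⁻¹(u) ∫₀^∞ g(u/c + it)(it)ʲ dt = iʲ (2π)^{-(j+1)} j! τ(χ⁻¹) L(g ⊗ χ, j + 1) ≠ 0`
   for `j + 1 > k/2 + 1`; but step 2 gives `S_j = ±(-1)^{n-j} χ(-1) S_j`, which fails for one of the
   two admissible consecutive values `j = n - 1, n` (they exist iff `n ≥ 5`).  Hence `ℂK^± = 0`,
   `K = 0`, and `Λ` spans `S^∨` over `ℝ` (reflexivity of the finite-dimensional `S`).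

The rank half (ii) — `rank_ℤ Λ ≤ 2 dim_ℂ S_{n+2}(Γ₁(N))`, i.e. Manin's presentation of the
weight-`k` modular symbols of `Γ₁(N)` together with the dimension formula for `S_k(Γ₁(N))` — is not
proved here; `heckeStableRealLatticeOfGenerators` records exactly what it has to deliver.

## Main results

* `cuspMoment_reflect`, `cuspCentredMoment_reflect`, `integral_cuspRayFn_reflect` (§B);
* `integral_translate_mul_pow_eq_mellin`, `mellin_translate_eq`, `sum_inv_mul_LSeries_translate`,
  `sum_inv_mul_integral_translate` (§A);
* `exists_common_eigenvector_of_stable`, `IsHeckeEigen`, `IsHeckeEigen.exists_recursion`,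
  `IsHeckeEigen.cuspCoeff_one_ne_zero`, `IsHeckeEigen.LSeries_twist_ne_zero` (§C);
* `span_eq_bot_of_reflect`, `span_rePeriodKerPlus_eq_bot`, `span_rePeriodKerMinus_eq_bot`,
  `eq_zero_of_isRePeriodVanishing`, **`periodLatticeK1_span_real_eq_top`**,
  `heckeStableRealLatticeOfGenerators` (§D).

Everything is proved; there are no named facts.

## References

* G. Shimura, *Introduction to the arithmetic theory of automorphic functions*, Publ. Math. Soc.
  Japan 11 (1971), Thm. 3.48 and (3.5.20) (pp. 83–84), §8.2 and Thm. 8.4.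
* F. Diamond, J. Shurman, *A first course in modular forms*, GTM 228 (2005), Prop. 5.8.5,
  Thm. 5.9.2, §5.10.
* W. Kohnen, D. Zagier, *Modular forms with rational periods*, in: Modular forms (Durham 1983),
  1984, §1.1 (even/odd periods and the action of `ε`).
-/

noncomputable section

open scoped MatrixGroups ModularForm ComplexConjugate Topology Manifold

open CongruenceSubgroup Complex MeasureTheory Set Filter Function Matrix.SpecialLinearGroup
open UpperHalfPlane hiding I

namespace Literature.NumberTheory.EllipticCurves.ModularForms

/-! ### §B. Reflection identities for the cusp moments on `ℂK^±` -/

section Reflection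

variable {N : ℕ} [NeZero N] {n : ℕ}

omit [NeZero N] in
/-- The cusp of `γ^ε = JγJ` is minus the cusp of `γ`. [folklore] -/
theorem cuspRe_jConj (γ : SL(2, ℤ)) : cuspRe (jConj γ) = -cuspRe γ := by
  simp only [cuspRe, jConj_apply_00, jConj_apply_10, Int.cast_neg]
  rw [div_neg]

omit [NeZero N] in
/-- `(γ^ε)₁₀ = -γ₁₀ ≠ 0`. [folklore] -/
theorem jConj_apply_10_ne_zero {γ : SL(2, ℤ)} (hc : (γ 1 0 : ℤ) ≠ 0) : (jConj γ 1 0 : ℤ) ≠ 0 := by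
  simpa using hc

/-- The integer vector `q = σ⁻¹ (-i, 1)`. [folklore] -/
def natPointPreimage (σ : SL(2, ℤ)) (i : ℕ) : Fin 2 → ℤ :=
  ((σ⁻¹ : SL(2, ℤ)) : Matrix (Fin 2) (Fin 2) ℤ).mulVec ![-(i : ℤ), 1]

omit [NeZero N] in
/-- `σ (σ⁻¹ (-i, 1)) = (-i, 1)` over `ℂ`. [folklore] -/
theorem icmat_mulVec_natPointPreimage (σ : SL(2, ℤ)) (i : ℕ) :
    (icmat σ).mulVec (fun l ↦ ((natPointPreimage σ i l : ℤ) : ℂ)) = ![-((i : ℕ) : ℂ), 1] := by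
  rw [icmat_mulVec_intCast, natPointPreimage, Matrix.mulVec_mulVec, ← Matrix.SpecialLinearGroup.coe_mul,
    mul_inv_cancel, Matrix.SpecialLinearGroup.coe_one, Matrix.one_mulVec]
  ext l
  fin_cases l <;> simp

omit [NeZero N] in
/-- `σ^ε (-u, v)` for `(u, v) = σ⁻¹(-i, 1)` is `(i, 1)`. [folklore] -/
theorem icmat_jConj_mulVec_negFstVec_natPointPreimage (σ : SL(2, ℤ)) (i : ℕ) :
    (icmat (jConj σ)).mulVec (fun l ↦ ((negFstVec (natPointPreimage σ i) l : ℤ) : ℂ)) =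
      ![((i : ℕ) : ℂ), 1] := by
  have h := icmat_mulVec_natPointPreimage σ i
  rw [← flatVec_intCast, ← flatVec_icmat_mulVec, h]
  ext l
  fin_cases l <;> simp [flatVec]

/-- **Reflection identity for the raw cusp moments**: if the periods of `g` satisfy
`λ_{σ,q}(g) = s · λ_{σ^ε,(-u,v)}(g)` for all `σ ∈ Γ₀(N)`, `q ∈ ℤ²` (as on the complex spans of
`K^±`, with `s = ±(-1)ⁿ`), then `M_j(g; σ) = s (-1)^{n-j} M_j(g; σ^ε)` for `σ ∈ Γ₀(N)` with `c ≠ 0`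
and `j ≤ n`.  (Evaluate at the integer points `q = σ⁻¹(-i, 1)`, `i = 0, …, n`, express both periods
through the cusp moments (`neg_periodFn1_eq_sum_cuspMoment`) and invert the Vandermonde matrix
`momentMatrix`.) [folklore] -/
theorem cuspMoment_reflect {g : CuspForm (Gamma1 N) (n + 2)} {s : ℂ}
    (hg : ∀ (σ : Gamma0 N) (q : Fin 2 → ℤ), periodFunctionalK1 n σ q g =
      s * periodFunctionalK1 n (jConj0 σ) (negFstVec q) g)
    (σ : Gamma0 N) (hc : ((σ : SL(2, ℤ)) 1 0 : ℤ) ≠ 0) {j : ℕ} (hj : j ≤ n) :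
    cuspMoment n g σ j = s * (-1) ^ (n - j) * cuspMoment n g (jConj (σ : SL(2, ℤ))) j := by
  classical
  have hc' : (jConj (σ : SL(2, ℤ)) 1 0 : ℤ) ≠ 0 := jConj_apply_10_ne_zero hc
  -- the two coefficient vectors
  set w : Fin (n + 1) → ℂ := fun j ↦ (n.choose j : ℂ) * cuspMoment n g σ j with hw
  set w' : Fin (n + 1) → ℂ := fun j ↦ (n.choose j : ℂ) *
    (s * (-1) ^ (n - (j : ℕ)) * cuspMoment n g (jConj (σ : SL(2, ℤ))) j) with hw'
  -- `M w = M w'`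
  have hM : (momentMatrix n).mulVec w = (momentMatrix n).mulVec w' := by
    funext i
    -- left: `-c_g(σ)(q)` with `σ q = (-i, 1)`
    have hL := neg_periodFn1_eq_sum_cuspMoment g (σ : SL(2, ℤ)) hc
      (fun l ↦ ((natPointPreimage (σ : SL(2, ℤ)) i l : ℤ) : ℂ))
    rw [icmat_mulVec_natPointPreimage] at hL
    -- right: `-c_g(σ^ε)(-u, v)` with `σ^ε(-u, v) = (i, 1)`
    have hR := neg_periodFn1_eq_sum_cuspMoment g (jConj (σ : SL(2, ℤ))) hc'
      (fun l ↦ ((negFstVec (natPointPreimage (σ : SL(2, ℤ)) i) l : ℤ) : ℂ))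
    rw [icmat_jConj_mulVec_negFstVec_natPointPreimage] at hR
    -- the reflection identity at this `q`
    have hq := hg σ (natPointPreimage (σ : SL(2, ℤ)) i)
    rw [periodFunctionalK1_apply, periodFunctionalK1_apply, coe_jConj0] at hq
    have key : ∑ j ∈ Finset.range (n + 1), (n.choose j : ℂ) * cuspMoment n g σ j *
        (1 : ℂ) ^ j * (-(-((i : ℕ) : ℂ))) ^ (n - j) =
        s * ∑ j ∈ Finset.range (n + 1), (n.choose j : ℂ) * cuspMoment n g (jConj (σ : SL(2, ℤ))) j *
          (1 : ℂ) ^ j * (-((i : ℕ) : ℂ)) ^ (n - j) := by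
      have h1 : -periodFn1 n g σ (fun l ↦ ((natPointPreimage (σ : SL(2, ℤ)) i l : ℤ) : ℂ)) =
          s * -periodFn1 n g (jConj (σ : SL(2, ℤ)))
            (fun l ↦ ((negFstVec (natPointPreimage (σ : SL(2, ℤ)) i) l : ℤ) : ℂ)) := by
        rw [hq]; ring
      simpa only [Matrix.cons_val_one, Matrix.cons_val_zero, Matrix.cons_val_fin_one] using
        hL.symm.trans (h1.trans (congrArg (s * ·) hR))
    simp only [Matrix.mulVec, dotProduct, momentMatrix, Matrix.of_apply, hw, hw']
    rw [Finset.sum_fin_eq_sum_range, Finset.sum_fin_eq_sum_range]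
    simp only [one_pow, mul_one, neg_neg] at key
    rw [Finset.mul_sum] at key
    refine (Finset.sum_congr rfl fun j hj ↦ ?_).trans (key.trans (Finset.sum_congr rfl fun j hj ↦ ?_))
    · rw [dif_pos (Finset.mem_range.mp hj)]
      ring
    · rw [dif_pos (Finset.mem_range.mp hj), neg_pow ((i : ℕ) : ℂ)]
      ring
  -- invert `M`
  have hww : w = w' := by
    have := congrArg ((momentMatrix n)⁻¹.mulVec ·) hM
    simpa only [Matrix.mulVec_mulVec, Matrix.nonsing_inv_mul _ isUnit_det_momentMatrix,
      Matrix.one_mulVec] using this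
  have hj' : j < n + 1 := Nat.lt_succ_of_le hj
  have := congr_fun hww ⟨j, hj'⟩
  simp only [hw, hw'] at this
  have hC : (n.choose j : ℂ) ≠ 0 := by exact_mod_cast (Nat.choose_pos hj).ne'
  exact mul_left_cancel₀ hC this

/-- **Reflection identity for the centred cusp moments**: under the hypothesis of
`cuspMoment_reflect`, `Q_j(g; σ) = s (-1)^{n-j} Q_j(g; σ^ε)` (`j ≤ n`; the cusp of `σ^ε` is
`-a/c`). [folklore] -/
theorem cuspCentredMoment_reflect {g : CuspForm (Gamma1 N) (n + 2)} {s : ℂ}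
    (hg : ∀ (σ : Gamma0 N) (q : Fin 2 → ℤ), periodFunctionalK1 n σ q g =
      s * periodFunctionalK1 n (jConj0 σ) (negFstVec q) g)
    (σ : Gamma0 N) (hc : ((σ : SL(2, ℤ)) 1 0 : ℤ) ≠ 0) {j : ℕ} (hj : j ≤ n) :
    cuspCentredMoment n g σ j =
      s * (-1) ^ (n - j) * cuspCentredMoment n g (jConj (σ : SL(2, ℤ))) j := by
  rw [cuspCentredMoment, cuspCentredMoment, cuspRe_jConj, Finset.mul_sum]
  refine Finset.sum_congr rfl fun i hi ↦ ?_
  have hij : i ≤ j := Nat.lt_succ_iff.mp (Finset.mem_range.mp hi)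
  rw [cuspMoment_reflect hg σ hc (hij.trans hj)]
  obtain ⟨a, rfl⟩ : ∃ a, j = i + a := ⟨j - i, by omega⟩
  obtain ⟨b, rfl⟩ : ∃ b, n = i + a + b := ⟨n - (i + a), by omega⟩
  rw [show i + a + b - i = a + b by omega, show i + a - i = a by omega,
    show i + a + b - (i + a) = b by omega]
  have h1 : ((-1 : ℂ) ^ a) ^ 2 = 1 := by
    rw [← pow_mul, mul_comm, pow_mul, neg_one_sq, one_pow]
  push_cast
  rw [neg_neg, neg_pow, pow_add]
  linear_combination (((i + a).choose i : ℂ) * s * (-1) ^ b *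
    cuspMoment (i + a + b) g (jConj (σ : SL(2, ℤ))) i * ((cuspRe (σ : SL(2, ℤ)) : ℂ)) ^ a) * h1

/-- **Reflection identity for the integrals from the cusps**: under the hypothesis of
`cuspMoment_reflect`, for `σ = (a *; c *) ∈ Γ₀(N)` with `c ≠ 0` and `n/2 < j ≤ n`,
`∫₀^∞ g(a/c + it)(it)ʲ dt = s (-1)^{n-j} ∫₀^∞ g(-a/c + it)(it)ʲ dt`. [folklore] -/
theorem integral_cuspRayFn_reflect {g : CuspForm (Gamma1 N) (n + 2)} {s : ℂ}
    (hg : ∀ (σ : Gamma0 N) (q : Fin 2 → ℤ), periodFunctionalK1 n σ q g =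
      s * periodFunctionalK1 n (jConj0 σ) (negFstVec q) g)
    (σ : Gamma0 N) (hc : ((σ : SL(2, ℤ)) 1 0 : ℤ) ≠ 0) {j : ℕ} (hjn : j ≤ n) (hj : n < 2 * j) :
    ∫ t in Ioi (0 : ℝ), cuspRayFn n g (cuspRe (σ : SL(2, ℤ))) j t =
      s * (-1) ^ (n - j) * ∫ t in Ioi (0 : ℝ), cuspRayFn n g (-cuspRe (σ : SL(2, ℤ))) j t := by
  have h1 := cuspCentredMoment_eq_integral g (σ : SL(2, ℤ)) hc hjn hj
  have h2 := cuspCentredMoment_eq_integral g (jConj (σ : SL(2, ℤ))) (jConj_apply_10_ne_zero hc) hjn hj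
  rw [cuspRe_jConj] at h2
  have h3 := cuspCentredMoment_reflect hg σ hc hjn
  rw [h1, h2] at h3
  have h4 : I * ∫ t in Ioi (0 : ℝ), cuspRayFn n g (cuspRe (σ : SL(2, ℤ))) j t =
      I * (s * (-1) ^ (n - j) * ∫ t in Ioi (0 : ℝ), cuspRayFn n g (-cuspRe (σ : SL(2, ℤ))) j t) := by
    rw [h3]; ring
  exact mul_left_cancel₀ I_ne_zero h4

omit [NeZero N] in
/-- **`1`-periodicity of the integrals from the cusps**: `∫₀^∞ g(x + 1 + it)(it)ʲ dt = ∫₀^∞ g(x + it)(it)ʲ dt`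
(`T ∈ Γ₁(N)`). [folklore] -/
theorem cuspRayFn_add_one [NeZero N] (g : CuspForm (Gamma1 N) (n + 2)) (x : ℝ) (j : ℕ) :
    cuspRayFn n g (x + 1) j = cuspRayFn n g x j := by
  funext t
  simp only [cuspRayFn]
  congr 1
  have := (isCuspFunction_one_gamma1 g).periodic ((x : ℂ) + t * I)
  simp only [Function.comp_apply] at this
  rw [← this]
  congr 2
  push_cast
  ring

omit [NeZero N] in
/-- **An element of `Γ₀(N)` with prescribed first column** `(a, c)`, `gcd(a, c) = 1`, `N ∣ c`.
[folklore] -/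
theorem exists_gamma0_fstCol (a c : ℤ) (hac : IsCoprime a c) (hN : (N : ℤ) ∣ c) :
    ∃ σ : Gamma0 N, ((σ : SL(2, ℤ)) 0 0 : ℤ) = a ∧ ((σ : SL(2, ℤ)) 1 0 : ℤ) = c := by
  obtain ⟨x, y, hxy⟩ := hac
  let M : SL(2, ℤ) := ⟨!![a, -y; c, x], by rw [Matrix.det_fin_two_of]; linear_combination hxy⟩
  refine ⟨⟨M, ?_⟩, rfl, rfl⟩
  rw [Gamma0_mem]
  change ((c : ℤ) : ZMod N) = 0
  obtain ⟨k, rfl⟩ := hN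
  push_cast
  rw [ZMod.natCast_self, zero_mul]

end Reflection

/-! ### §A. The integrals from the cusps `u/c` as Mellin transforms, and their character sums -/

section Mellin

variable {N : ℕ} [NeZero N] {k : ℤ}

omit [NeZero N] in
/-- **The integral from the cusp `q` is a Mellin transform of the translate `g(q + ·)`**:
`∫₀^∞ g(q + it)(it)ʲ dt = iʲ · 𝓜[t ↦ g_q(it)](j + 1)`. [folklore] -/
theorem integral_translate_mul_pow_eq_mellin (g : CuspForm (Gamma1 N) k) (q : ℚ) (j : ℕ) :
    ∫ t in Ioi (0 : ℝ), g (ofComplex ((q : ℂ) + t * I)) * ((t : ℂ) * I) ^ j =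
      I ^ j * mellin (fun t : ℝ ↦ translateCuspForm g q (ofComplex (I * t))) ((j : ℂ) + 1) := by
  rw [mellin, ← integral_const_mul]
  refine setIntegral_congr_fun measurableSet_Ioi fun t ht ↦ ?_
  have h := imagAxis_translateCuspForm g q ht
  simp only at h
  rw [h, add_sub_cancel_right, cpow_natCast, smul_eq_mul]
  ring

/-- **Hecke**: `𝓜[t ↦ g_q(it)](s) = (2π)^{-s} Γ(s) ∑ e(qm) aₘ m^{-s}` for `re s > k/2 + 1`,
`re s > 0` (`heckeContinuation_translateCuspForm_eq`). [folklore] -/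
theorem mellin_translate_eq (g : CuspForm (Gamma1 N) k) (q : ℚ) {s : ℂ}
    (hs : (k : ℝ) / 2 + 1 < s.re) (hs₀ : 0 < s.re) :
    mellin (fun t : ℝ ↦ translateCuspForm g q (ofComplex (I * t))) s =
      (2 * Real.pi : ℂ) ^ (-s) * Complex.Gamma s *
        LSeries (fun m ↦ Complex.exp (2 * Real.pi * I * q * m) * cuspCoeff g m) s := by
  have h := heckeContinuation_translateCuspForm_eq (strictWidthInfty_Gamma1 N) g q hs
  have h2π : (2 * Real.pi : ℂ) ^ s ≠ 0 := by
    rw [Ne, cpow_eq_zero_iff, not_and_or]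
    exact Or.inl (by exact_mod_cast Real.two_pi_pos.ne')
  have hΓ : Complex.Gamma s ≠ 0 := Complex.Gamma_ne_zero_of_re_pos hs₀
  rw [← h, cpow_neg]
  field_simp

variable {c : ℕ} [NeZero c]

omit [NeZero N] in
/-- **Character sums of additively twisted `L`-series**: for a primitive `χ` mod `c`,
`∑_{u mod c} χ⁻¹(u) ∑ₘ e(um/c) aₘ m^{-s} = τ(χ⁻¹) ∑ₘ χ(m) aₘ m^{-s}` (`re s > k/2 + 1`), by the
Gauss-sum identity `∑_u χ⁻¹(u) e(um/c) = χ(m) τ(χ⁻¹)` (Mathlib `gaussSum_mulShift_of_isPrimitive`).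
[folklore] -/
theorem sum_inv_mul_LSeries_translate [NeZero N] (g : CuspForm (Gamma1 N) k) {χ : DirichletCharacter ℂ c}
    (hχ : χ.IsPrimitive) {s : ℂ} (hs : (k : ℝ) / 2 + 1 < s.re) :
    ∑ u : ZMod c, χ⁻¹ u *
      LSeries (fun m ↦ Complex.exp (2 * Real.pi * I * (((u.val : ℚ) / c : ℚ)) * m) * cuspCoeff g m) s =
      gaussSum χ⁻¹ (ZMod.stdAddChar (N := c)) * LSeries (fun m ↦ χ m * cuspCoeff g m) s := by
  have hfun : (gaussSum χ⁻¹ (ZMod.stdAddChar (N := c))) • (fun m : ℕ ↦ χ m * cuspCoeff g m) =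
      ∑ u : ZMod c, (χ⁻¹ u) •
        (fun m : ℕ ↦ Complex.exp (2 * Real.pi * I * (((u.val : ℚ) / c : ℚ)) * m) * cuspCoeff g m) := by
    funext m
    simp only [Finset.sum_apply, Pi.smul_apply, smul_eq_mul]
    rw [show gaussSum χ⁻¹ (ZMod.stdAddChar (N := c)) * (χ m * cuspCoeff g m) =
      (χ m * gaussSum χ⁻¹ (ZMod.stdAddChar (N := c))) * cuspCoeff g m by ring,
      ← sum_inv_mul_stdAddChar_eq hχ m, Finset.sum_mul]
    refine Finset.sum_congr rfl fun u _ ↦ ?_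
    rw [stdAddChar_mul_natCast]
    ring
  rw [← LSeries_smul, hfun, LSeries_sum (fun u _ ↦ (LSeriesSummable_translate
    (strictWidthInfty_Gamma1 N) g _ hs).smul _)]
  refine Finset.sum_congr rfl fun u _ ↦ ?_
  rw [LSeries_smul]

/-- **The character sum of the integrals from the cusps `u/c` is a twisted `L`-value**: for a
primitive `χ` mod `c`, `g ∈ S_k(Γ₁(N))` and an integer `j` with `k/2 < j`,
`∑_{u mod c} χ⁻¹(u) ∫₀^∞ g(u/c + it)(it)ʲ dt = iʲ (2π)^{-(j+1)} j! τ(χ⁻¹) L(g ⊗ χ, j + 1)`.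
[folklore] -/
theorem sum_inv_mul_integral_translate (g : CuspForm (Gamma1 N) k) {χ : DirichletCharacter ℂ c}
    (hχ : χ.IsPrimitive) {j : ℕ} (hj : (k : ℝ) / 2 + 1 < (j : ℝ) + 1) :
    ∑ u : ZMod c, χ⁻¹ u * ∫ t in Ioi (0 : ℝ),
      g (ofComplex (((((u.val : ℚ) / c : ℚ)) : ℂ) + t * I)) * ((t : ℂ) * I) ^ j =
      I ^ j * ((2 * Real.pi : ℂ) ^ (-((j : ℂ) + 1)) * Complex.Gamma ((j : ℂ) + 1)) *
        (gaussSum χ⁻¹ (ZMod.stdAddChar (N := c)) * LSeries (fun m ↦ χ m * cuspCoeff g m) ((j : ℂ) + 1)) := by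
  have hs : (k : ℝ) / 2 + 1 < (((j : ℂ) + 1 : ℂ)).re := by simpa using hj
  have hs₀ : 0 < (((j : ℂ) + 1 : ℂ)).re := by
    simp only [add_re, natCast_re, one_re]; positivity
  rw [← sum_inv_mul_LSeries_translate g hχ hs, Finset.mul_sum]
  refine Finset.sum_congr rfl fun u _ ↦ ?_
  rw [integral_translate_mul_pow_eq_mellin, mellin_translate_eq g _ hs hs₀]
  ring

end Mellin

/-! ### §C. Simultaneous Hecke eigenvectors in stable subspaces, and their coefficients -/

section Eigen

/-- **Commuting operators have a common eigenvector in every non-zero finite-dimensional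
subspace they preserve** (over `ℂ`): a minimal non-zero stable subspace on which some operator is
not scalar contains a proper non-zero stable eigenspace — induction on the dimension. [folklore] -/
theorem exists_common_eigenvector_of_stable {W : Type*} [AddCommGroup W] [Module ℂ W]
    (𝒮 : Set (Module.End ℂ W)) (hcomm : ∀ S ∈ 𝒮, ∀ T ∈ 𝒮, S * T = T * S) :
    ∀ (d : ℕ) (V : Submodule ℂ W), FiniteDimensional ℂ V → Module.finrank ℂ V = d → V ≠ ⊥ →
      (∀ T ∈ 𝒮, ∀ v ∈ V, T v ∈ V) → ∃ w ∈ V, w ≠ 0 ∧ ∀ T ∈ 𝒮, ∃ a : ℂ, T w = a • w := by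
  intro d
  induction d using Nat.strong_induction_on with
  | _ d ih =>
    intro V hfin hd hV hstab
    by_cases hscal : ∀ T ∈ 𝒮, ∃ a : ℂ, ∀ v ∈ V, T v = a • v
    · obtain ⟨w, hwV, hw0⟩ := (Submodule.ne_bot_iff V).mp hV
      exact ⟨w, hwV, hw0, fun T hT ↦ (hscal T hT).imp fun a ha ↦ ha w hwV⟩
    · push Not at hscal
      obtain ⟨T, hT, hTns⟩ := hscal
      -- an eigenvalue of `T|_V`
      haveI : Nontrivial V := Submodule.nontrivial_iff_ne_bot.mpr hV
      let T' : Module.End ℂ V := T.restrict fun v hv ↦ hstab T hT v hv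
      obtain ⟨a, ha⟩ := Module.End.exists_eigenvalue T'
      obtain ⟨⟨v₀, hv₀V⟩, hv₀⟩ := ha.exists_hasEigenvector
      -- the eigenspace inside `V`
      set E : Submodule ℂ W := V ⊓ LinearMap.ker (T - a • LinearMap.id) with hE
      have hmemE : ∀ {v : W}, v ∈ E ↔ v ∈ V ∧ T v = a • v := by
        intro v
        rw [hE, Submodule.mem_inf, LinearMap.mem_ker, LinearMap.sub_apply, LinearMap.smul_apply,
          LinearMap.id_apply, sub_eq_zero]
      have hEV : E ≤ V := inf_le_left
      have hE0 : E ≠ ⊥ := by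
        rw [Submodule.ne_bot_iff]
        refine ⟨v₀, hmemE.mpr ⟨hv₀V, ?_⟩, fun h ↦ hv₀.2 (Subtype.ext h)⟩
        have := hv₀.apply_eq_smul
        simpa [T', LinearMap.restrict_apply, Subtype.ext_iff] using this
      have hEne : E ≠ V := by
        intro hEV'
        obtain ⟨v, hv, hvne⟩ := hTns a
        exact hvne ((hmemE.mp (hEV' ▸ hv)).2)
      have hElt : Module.finrank ℂ E < d := by
        rw [← hd]
        exact Submodule.finrank_lt_finrank_of_lt (lt_of_le_of_ne hEV hEne)
      have hEstab : ∀ S ∈ 𝒮, ∀ v ∈ E, S v ∈ E := by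
        intro S hS v hv
        obtain ⟨hvV, hTv⟩ := hmemE.mp hv
        refine hmemE.mpr ⟨hstab S hS v hvV, ?_⟩
        have := congrArg (fun F : Module.End ℂ W ↦ F v) (hcomm T hT S hS)
        simp only [Module.End.mul_apply] at this
        rw [this, hTv, map_smul]
      haveI : FiniteDimensional ℂ E := Submodule.finiteDimensional_of_le hEV
      obtain ⟨w, hwE, hw0, hw⟩ := ih _ hElt E inferInstance rfl hE0 hEstab
      exact ⟨w, hEV hwE, hw0, hw⟩

variable {N : ℕ} [NeZero N] {k : ℤ}

/-- A **Hecke eigensystem** for `g ∈ S_k(Γ₁(N))`: `g` is a Hecke eigenform in the sense of the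
tree (`IsHeckeEigenform`, `Newforms`: an eigenvector of `T_p` for every prime `p`, `U_p` for `p ∣ N`
included) and moreover an eigenvector of `⟨d⟩` for every unit `d`.  The recursion lemmas below add
the diamond eigenvalue to the level-`Γ₀(N)` coefficient recursions of `NewformsLevelRaising`.
[folklore] -/
def IsHeckeEigen (g : CuspForm (Gamma1 N) k) : Prop :=
  IsHeckeEigenform g ∧ ∀ d : (ZMod N)ˣ, ∃ e : ℂ, diamondOp N k (d : ZMod N) g = e • g

/-- Being an eigenvector of every element of `heckeGens1` is being a Hecke eigensystem. [folklore] -/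
theorem isHeckeEigen_of_forall_heckeGens1 {g : CuspForm (Gamma1 N) k}
    (h : ∀ T ∈ heckeGens1 N k, ∃ a : ℂ, T g = a • g) : IsHeckeEigen g := by
  refine ⟨fun p hp ↦ ?_, fun d ↦ ?_⟩
  · exact h _ (Or.inl ⟨p, hp, rfl⟩)
  · exact h _ (Or.inr ⟨d, rfl⟩)

/-- A Hecke eigensystem is preserved under scaling. [folklore] -/
theorem IsHeckeEigen.smul {g : CuspForm (Gamma1 N) k} (hg : IsHeckeEigen g) (c : ℂ) :
    IsHeckeEigen (c • g) := by
  refine ⟨fun p hp ↦ ?_, fun d ↦ ?_⟩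
  · obtain ⟨a, ha⟩ := hg.1 p hp
    exact ⟨a, by rw [map_smul, ha, smul_comm]⟩
  · obtain ⟨e, he⟩ := hg.2 d
    exact ⟨e, by rw [map_smul, he, smul_comm]⟩

omit [NeZero N] in
/-- `aₘ(c g) = c aₘ(g)` (a local copy of `cuspCoeff_smul_gamma1` of `NewformsSpanGamma1Proofs`, not
imported here). [folklore] -/
private theorem cuspCoeff_smul_aux (c : ℂ) (g : CuspForm (Gamma1 N) k) (m : ℕ) :
    cuspCoeff (c • g) m = c * cuspCoeff g m := by
  have := (cuspCoeffₗ (HeckeTGamma1.one_mem_strictPeriods_Gamma1 N) (k := k) m).map_smul c g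
  simpa only [cuspCoeffₗ_apply, smul_eq_mul] using this

omit [NeZero N] in
/-- `aₘ(0) = 0`. [folklore] -/
private theorem cuspCoeff_zero_aux (m : ℕ) : cuspCoeff (0 : CuspForm (Gamma1 N) k) m = 0 := by
  have := (cuspCoeffₗ (HeckeTGamma1.one_mem_strictPeriods_Gamma1 N) (k := k) m).map_zero
  simpa only [cuspCoeffₗ_apply] using this

/-- **The Hecke recursion for the coefficients of an eigensystem** (Diamond–Shurman Prop. 5.8.5 at
prime arguments, `U_p` for `p ∣ N` included): for every prime `p` there are `λ, μ ∈ ℂ` with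
`a(pm) = λ a(m) - μ 𝟙_{p∣m} a(m/p)` for all `m` (`λ` the `T_p`-eigenvalue, `μ = ε(p) p^{k-1}` for
`p ∤ N`, `μ = 0` for `p ∣ N`), from the `q`-expansion of `T_p`
(`qExpansion_coeff_heckeT_gamma1_holds`). [cite: DiamondShurman2005, Prop. 5.8.5] -/
theorem IsHeckeEigen.exists_recursion {g : CuspForm (Gamma1 N) k} (hg : IsHeckeEigen g) (p : ℕ)
    (hp : p.Prime) : ∃ lam mu : ℂ, ∀ m : ℕ,
      cuspCoeff g (p * m) = lam * cuspCoeff g m - mu * (if p ∣ m then cuspCoeff g (m / p) else 0) := by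
  haveI : NeZero p := ⟨hp.ne_zero⟩
  obtain ⟨lam, hlam⟩ := hg.1 p hp
  -- the diamond eigenvalue at `p` (only needed for `p ∤ N`)
  have hdia : ∃ e : ℂ, ¬ p ∣ N → diamondOp N k (p : ZMod N) g = e • g := by
    by_cases hpN : p ∣ N
    · exact ⟨0, fun h ↦ absurd hpN h⟩
    · obtain ⟨u, hu⟩ := ZMod.isUnit_prime_of_not_dvd hp hpN
      obtain ⟨e, he⟩ := hg.2 u
      exact ⟨e, fun _ ↦ by rw [← hu, he]⟩
  obtain ⟨e, he⟩ := hdia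
  refine ⟨lam, if p ∣ N then 0 else (p : ℂ) ^ (k - 1) * e, fun m ↦ ?_⟩
  have h := qExpansion_coeff_heckeT_gamma1_holds N k g p hp m
  change cuspCoeff (heckeT (Gamma1 N) k p g) m = cuspCoeff g (p * m) +
    (if p ∣ N then 0 else (p : ℂ) ^ (k - 1) *
      (if p ∣ m then cuspCoeff (diamondOp N k p g) (m / p) else 0)) at h
  rw [hlam, cuspCoeff_smul_aux] at h
  by_cases hpN : p ∣ N
  · rw [if_pos hpN, add_zero] at h
    rw [if_pos hpN, zero_mul, sub_zero, h]
  · rw [if_neg hpN, he hpN] at h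
    rw [if_neg hpN]
    by_cases hpm : p ∣ m
    · rw [if_pos hpm, cuspCoeff_smul_aux] at h
      rw [if_pos hpm]
      linear_combination -h
    · rw [if_neg hpm, mul_zero, add_zero] at h
      rw [if_neg hpm, mul_zero, sub_zero, h]

/-- **A non-zero Hecke eigensystem has `a₁ ≠ 0`**: if `a₁ = 0` the recursion forces all
coefficients to vanish, and a cusp form with zero `q`-expansion is zero. [folklore] -/
theorem IsHeckeEigen.cuspCoeff_one_ne_zero {g : CuspForm (Gamma1 N) k} (hg : IsHeckeEigen g)
    (hg0 : g ≠ 0) : cuspCoeff g 1 ≠ 0 := by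
  intro h1
  apply hg0
  have hall : ∀ m : ℕ, cuspCoeff g m = 0 := by
    intro m
    induction m using Nat.strong_induction_on with
    | _ m ih =>
      rcases Nat.lt_or_ge m 2 with hm | hm
      · interval_cases m
        · exact CuspFormClass.qExpansion_coeff_zero g one_pos
            (HeckeTGamma1.one_mem_strictPeriods_Gamma1 N)
        · exact h1
      · obtain ⟨p, hp, hpm⟩ := Nat.exists_prime_and_dvd (show m ≠ 1 by omega)
        obtain ⟨m', rfl⟩ := hpm
        obtain ⟨lam, mu, hrec⟩ := hg.exists_recursion p hp
        have hm' : m' < p * m' := lt_mul_left (Nat.pos_of_ne_zero (by rintro rfl; omega)) hp.one_lt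
        rw [hrec m', ih m' hm']
        split_ifs with hpm'
        · rw [ih (m' / p) ((Nat.div_le_self _ _).trans_lt hm')]
          ring
        · ring
  exact eq_of_forall_cuspCoeff_eq (HeckeTGamma1.one_mem_strictPeriods_Gamma1 N) fun m ↦ by
    rw [hall m, cuspCoeff_zero_aux]

/-- **Non-vanishing of the twisted `L`-series of a normalised Hecke eigensystem** in the
half-plane of absolute convergence: `∑ χ(m) aₘ m^{-s} ≠ 0` for `re s > k/2 + 1`
(`HeckeRecursionLSeries.LSeries_ne_zero_of_heckeRecursion` with the twisted recursion
`b(pm) = χ(p)λ b(m) - χ(p)²μ 𝟙_{p∣m} b(m/p)`). [folklore] -/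
theorem IsHeckeEigen.LSeries_twist_ne_zero {g : CuspForm (Gamma1 N) k} (hg : IsHeckeEigen g)
    (h1 : cuspCoeff g 1 = 1) {c : ℕ} (χ : DirichletCharacter ℂ c) {s : ℂ}
    (hs : (k : ℝ) / 2 + 1 < s.re) :
    LSeries (fun m ↦ χ m * cuspCoeff g m) s ≠ 0 := by
  refine HeckeRecursionLSeries.LSeries_ne_zero_of_heckeRecursion (by simp [h1]) (fun p hp ↦ ?_) ?_
  · obtain ⟨lam, mu, hrec⟩ := hg.exists_recursion p hp
    refine ⟨χ p * lam, χ p * χ p * mu, fun m _ ↦ ?_⟩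
    rw [Nat.cast_mul, map_mul, hrec m]
    by_cases hpm : p ∣ m
    · rw [if_pos hpm, if_pos hpm]
      obtain ⟨m', rfl⟩ := hpm
      rw [Nat.mul_div_cancel_left m' hp.pos, Nat.cast_mul, map_mul]
      ring
    · rw [if_neg hpm, if_neg hpm]
      ring
  · refine HeckeRecursionLSeries.lseriesSummable_of_norm_le (fun m _ ↦ ?_)
      (LSeriesSummable_cuspCoeff (strictWidthInfty_Gamma1 N) g hs)
    rw [norm_mul]
    exact mul_le_of_le_one_left (norm_nonneg _) (DirichletCharacter.norm_le_one χ m)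

end Eigen

/-! ### §D. `K = 0` in weights `≥ 7`, and the real span of the period lattice -/

section Assembly

variable {N : ℕ} [NeZero N] {n : ℕ}

/-- `S_k(Γ₁(N))` is finite-dimensional (Sturm, `finiteDimensional_cuspForm_and_finrank_le`).
[folklore] -/
instance instFiniteDimensionalCuspFormGamma1 (k : ℤ) : FiniteDimensional ℂ (CuspForm (Gamma1 N) k) :=
  (finiteDimensional_cuspForm_and_finrank_le (HeckeTGamma1.one_mem_strictPeriods_Gamma1 N)).1

omit [NeZero N] in
/-- The cusp `u/c` of the unit `u ∈ (ℤ/c)ˣ` is `Γ₀(N)`-equivalent to `∞` when `N ∣ c`: there is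
`σ ∈ Γ₀(N)` with lower-left entry `c` and cusp `σ∞ = u/c`. [folklore] -/
theorem exists_gamma0_cuspRe {c : ℕ} [NeZero c] (hNc : N ∣ c) (u : ZMod c) (hu : IsUnit u) :
    ∃ σ : Gamma0 N, ((σ : SL(2, ℤ)) 1 0 : ℤ) = c ∧ cuspRe (σ : SL(2, ℤ)) = (u.val : ℝ) / c := by
  have hcop : IsCoprime (u.val : ℤ) (c : ℤ) := by
    have h := ZMod.val_coe_unit_coprime hu.unit
    rw [hu.unit_spec] at h
    exact Nat.isCoprime_iff_coprime.mpr h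
  obtain ⟨σ, h00, h10⟩ := exists_gamma0_fstCol (N := N) (u.val : ℤ) c hcop (by exact_mod_cast hNc)
  refine ⟨σ, h10, ?_⟩
  rw [cuspRe, h00, h10]
  push_cast
  ring

/-- `(-u).val / c` and `-(u.val / c)` differ by an integer (`0` or `1`). [folklore] -/
theorem neg_val_div_eq {c : ℕ} [NeZero c] (u : ZMod c) :
    ((-u).val : ℝ) / c = -((u.val : ℝ) / c) ∨ ((-u).val : ℝ) / c = -((u.val : ℝ) / c) + 1 := by
  rw [ZMod.neg_val]
  split_ifs with hu
  · left
    rw [hu, ZMod.val_zero, Nat.cast_zero, zero_div, neg_zero]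
  · right
    have hc : (c : ℝ) ≠ 0 := by exact_mod_cast NeZero.ne c
    rw [Nat.cast_sub (ZMod.val_lt u).le]
    field_simp
    ring

/-- **The twisted sums of the integrals from the cusps transform by `t χ⁻¹(-1)` under the
reflection**: if `∫₀^∞ g(x + it)(it)ʲ dt = t · ∫₀^∞ g(-x + it)(it)ʲ dt` for every cusp `x = u/c`,
`u ∈ (ℤ/c)ˣ`, then `S = t χ⁻¹(-1) S` for `S = ∑_u χ⁻¹(u) ∫₀^∞ g(u/c + it)(it)ʲ dt`. [folklore] -/
theorem sum_inv_mul_integral_cuspRayFn_reflect {c : ℕ} [NeZero c] (g : CuspForm (Gamma1 N) (n + 2))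
    (χ : DirichletCharacter ℂ c) (j : ℕ) {t : ℂ}
    (hrefl : ∀ u : ZMod c, IsUnit u → ∫ x in Ioi (0 : ℝ), cuspRayFn n g ((u.val : ℝ) / c) j x =
      t * ∫ x in Ioi (0 : ℝ), cuspRayFn n g (-((u.val : ℝ) / c)) j x) :
    ∑ u : ZMod c, χ⁻¹ u * ∫ x in Ioi (0 : ℝ), cuspRayFn n g ((u.val : ℝ) / c) j x =
      t * χ⁻¹ (-1) * ∑ u : ZMod c, χ⁻¹ u * ∫ x in Ioi (0 : ℝ), cuspRayFn n g ((u.val : ℝ) / c) j x := by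
  -- reflect each term and move to the cusp `(-u)/c`
  have hterm : ∀ u : ZMod c, χ⁻¹ u * ∫ x in Ioi (0 : ℝ), cuspRayFn n g ((u.val : ℝ) / c) j x =
      t * (χ⁻¹ u * ∫ x in Ioi (0 : ℝ), cuspRayFn n g (((-u).val : ℝ) / c) j x) := by
    intro u
    by_cases hu : IsUnit u
    · rw [hrefl u hu]
      rcases neg_val_div_eq u with h | h
      · rw [h]; ring
      · rw [h, cuspRayFn_add_one]; ring
    · rw [MulChar.map_nonunit _ hu, zero_mul, zero_mul, mul_zero]
  conv_lhs => rw [Finset.sum_congr rfl fun u _ ↦ hterm u]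
  rw [← Finset.mul_sum, mul_assoc]
  congr 1
  -- reindex `u ↦ -u`
  rw [Finset.mul_sum]
  conv_lhs => rw [← Equiv.sum_comp (Equiv.neg (ZMod c))]
  refine Finset.sum_congr rfl fun u _ ↦ ?_
  simp only [Equiv.neg_apply, neg_neg]
  rw [show χ⁻¹ (-u) = χ⁻¹ (-1) * χ⁻¹ u by rw [← map_mul, neg_one_mul]]
  ring

/-- **The main lemma: a Hecke- and diamond-stable set of forms whose complex span satisfies a
reflection identity of fixed sign is `{0}`** (weight `n + 2 ≥ 7`).  If `ℂS` were non-zero it would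
contain a normalised simultaneous Hecke eigenform `g` (`exists_common_eigenvector_of_stable`,
`IsHeckeEigen.cuspCoeff_one_ne_zero`); for a primitive `χ` mod `N²` (`exists_isPrimitive_sq`) and
`j ∈ {n-1, n}` the character sums `S_j = ∑_u χ⁻¹(u) ∫₀^∞ g(u/N² + it)(it)ʲ dt` are non-zero
multiples of `L(g ⊗ χ, j+1) ≠ 0` (`sum_inv_mul_integral_translate`,
`IsHeckeEigen.LSeries_twist_ne_zero`, `gaussSum_stdAddChar_ne_zero_of_isPrimitive`), while the
reflection identity gives `S_j = s(-1)^{n-j} χ⁻¹(-1) S_j` (`integral_cuspRayFn_reflect`,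
`sum_inv_mul_integral_cuspRayFn_reflect`), i.e. `s χ⁻¹(-1) = 1` and `-s χ⁻¹(-1) = 1`. [folklore] -/
theorem span_eq_bot_of_reflect (hn : 5 ≤ n) (S : Set (CuspForm (Gamma1 N) (n + 2))) (s : ℂ)
    (hrefl : ∀ g ∈ Submodule.span ℂ S, ∀ (σ : Gamma0 N) (q : Fin 2 → ℤ),
      periodFunctionalK1 n σ q g = s * periodFunctionalK1 n (jConj0 σ) (negFstVec q) g)
    (hT : ∀ g ∈ Submodule.span ℂ S, ∀ (p : ℕ) (hp : p.Prime),
      (haveI : NeZero p := ⟨hp.ne_zero⟩; heckeT (Gamma1 N) (n + 2) p g) ∈ Submodule.span ℂ S)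
    (hD : ∀ g ∈ Submodule.span ℂ S, ∀ d : ZMod N, diamondOp N (n + 2) d g ∈ Submodule.span ℂ S) :
    Submodule.span ℂ S = ⊥ := by
  by_contra hV
  set V := Submodule.span ℂ S with hVdef
  -- a simultaneous eigenvector in `V`
  have hstab : ∀ T ∈ heckeGens1 N (n + 2), ∀ v ∈ V, T v ∈ V := by
    rintro T (⟨p, hp, rfl⟩ | ⟨d, rfl⟩) v hv
    · exact hT v hv p hp
    · exact hD v hv d
  obtain ⟨g₀, hg₀V, hg₀0, hg₀⟩ := exists_common_eigenvector_of_stable (heckeGens1 N (n + 2))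
    heckeGens1_comm _ V inferInstance rfl hV hstab
  have heig₀ : IsHeckeEigen g₀ := isHeckeEigen_of_forall_heckeGens1 hg₀
  -- normalise
  have ha1 : cuspCoeff g₀ 1 ≠ 0 := heig₀.cuspCoeff_one_ne_zero hg₀0
  set g : CuspForm (Gamma1 N) (n + 2) := (cuspCoeff g₀ 1)⁻¹ • g₀ with hgdef
  have hgV : g ∈ V := V.smul_mem _ hg₀V
  have heig : IsHeckeEigen g := heig₀.smul _
  have hg1 : cuspCoeff g 1 = 1 := by rw [hgdef, cuspCoeff_smul_aux, inv_mul_cancel₀ ha1]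
  -- the character
  obtain ⟨χ, hχ⟩ := exists_isPrimitive_sq N
  haveI : NeZero (N ^ 2) := ⟨pow_ne_zero 2 (NeZero.ne N)⟩
  have hNc : N ∣ N ^ 2 := dvd_pow_self N two_ne_zero
  -- the twisted sums `S_j` and their two properties
  have key : ∀ j : ℕ, j ≤ n → n + 2 < 2 * j → s * (-1) ^ (n - j) * χ⁻¹ (-1) = 1 := by
    intro j hjn hj
    -- reflection termwise
    have hrefl_u : ∀ u : ZMod (N ^ 2), IsUnit u →
        ∫ x in Ioi (0 : ℝ), cuspRayFn n g ((u.val : ℝ) / (N ^ 2 : ℕ)) j x =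
          s * (-1) ^ (n - j) * ∫ x in Ioi (0 : ℝ), cuspRayFn n g (-((u.val : ℝ) / (N ^ 2 : ℕ))) j x := by
      intro u hu
      obtain ⟨σ, h10, hcusp⟩ := exists_gamma0_cuspRe hNc u hu
      have hc0 : ((σ : SL(2, ℤ)) 1 0 : ℤ) ≠ 0 := by rw [h10]; exact_mod_cast NeZero.ne (N ^ 2)
      have h := integral_cuspRayFn_reflect (hrefl g hgV) σ hc0 hjn (by omega)
      rwa [hcusp] at h
    have hS := sum_inv_mul_integral_cuspRayFn_reflect g χ j hrefl_u
    -- `S_j ≠ 0`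
    have hSne : ∑ u : ZMod (N ^ 2), χ⁻¹ u *
        ∫ x in Ioi (0 : ℝ), cuspRayFn n g ((u.val : ℝ) / (N ^ 2 : ℕ)) j x ≠ 0 := by
      have hjk : ((((n : ℤ) + 2 : ℤ)) : ℝ) / 2 + 1 < (j : ℝ) + 1 := by
        have : ((n : ℝ) + 2) < 2 * j := by exact_mod_cast hj
        push_cast
        linarith
      have hval := sum_inv_mul_integral_translate g hχ hjk
      have hcast : ∀ u : ZMod (N ^ 2), ∀ x : ℝ,
          g (ofComplex (((((u.val : ℚ) / (N ^ 2 : ℕ) : ℚ)) : ℂ) + x * I)) * ((x : ℂ) * I) ^ j =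
            cuspRayFn n g ((u.val : ℝ) / (N ^ 2 : ℕ)) j x := by
        intro u x
        rw [cuspRayFn]
        push_cast
        ring_nf
      simp_rw [hcast] at hval
      rw [hval]
      refine mul_ne_zero (mul_ne_zero (pow_ne_zero _ I_ne_zero) (mul_ne_zero ?_ ?_)) (mul_ne_zero ?_ ?_)
      · rw [Ne, cpow_eq_zero_iff, not_and_or]
        exact Or.inl (by exact_mod_cast Real.two_pi_pos.ne')
      · exact Complex.Gamma_ne_zero_of_re_pos (by simp only [add_re, natCast_re, one_re]; positivity)
      · exact gaussSum_stdAddChar_ne_zero_of_isPrimitive (isPrimitive_inv hχ)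
      · exact heig.LSeries_twist_ne_zero hg1 χ (by
          have : ((n : ℝ) + 2) < 2 * j := by exact_mod_cast hj
          simp only [add_re, natCast_re, one_re]
          push_cast
          linarith)
    -- compare
    have h3 : (1 - s * (-1) ^ (n - j) * χ⁻¹ (-1)) * ∑ u : ZMod (N ^ 2), χ⁻¹ u *
        ∫ x in Ioi (0 : ℝ), cuspRayFn n g ((u.val : ℝ) / (N ^ 2 : ℕ)) j x = 0 := by
      linear_combination hS
    rcases mul_eq_zero.mp h3 with h | h
    · linear_combination -h
    · exact absurd h hSne
  -- `j = n` and `j = n - 1`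
  have h1 := key n le_rfl (by omega)
  have h2 := key (n - 1) (Nat.sub_le n 1) (by omega)
  rw [Nat.sub_self, pow_zero, mul_one] at h1
  rw [show n - (n - 1) = 1 by omega, pow_one] at h2
  have : (1 : ℂ) = -1 := by linear_combination -h1 - h2
  norm_num at this

/-- **`ℂK⁺ = 0` in weights `≥ 7`.** [folklore] -/
theorem span_rePeriodKerPlus_eq_bot (hn : 5 ≤ n) :
    Submodule.span ℂ (rePeriodKerPlus N n) = ⊥ :=
  span_eq_bot_of_reflect hn _ ((-1) ^ n)
    (fun _ hg σ q ↦ periodFunctionalK1_eq_of_mem_span_plus hg σ q)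
    (fun _ hg p hp ↦ by haveI : NeZero p := ⟨hp.ne_zero⟩; exact heckeT_mem_span_plus hg p hp)
    (fun _ hg d ↦ diamondOp_mem_span_plus hg d)

/-- **`ℂK⁻ = 0` in weights `≥ 7`.** [folklore] -/
theorem span_rePeriodKerMinus_eq_bot (hn : 5 ≤ n) :
    Submodule.span ℂ (rePeriodKerMinus N n) = ⊥ :=
  span_eq_bot_of_reflect hn _ ((-1) ^ (n + 1))
    (fun _ hg σ q ↦ periodFunctionalK1_eq_of_mem_span_minus hg σ q)
    (fun _ hg p hp ↦ by haveI : NeZero p := ⟨hp.ne_zero⟩; exact heckeT_mem_span_minus hg p hp)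
    (fun _ hg d ↦ diamondOp_mem_span_minus hg d)

/-- **Injectivity of the real Eichler–Shimura map on `S_{n+2}(Γ₁(N))`, `n ≥ 5`**: a cusp form all of
whose Eichler–Shimura periods are purely imaginary is zero (Shimura 1971, Thm. 8.4, the injectivity
of `f ↦ (re ∫ f(z)(zv - u)ⁿ dz)` for the weights `k ≥ 7`). [cite: Shimura1971, Thm. 8.4] -/
theorem eq_zero_of_isRePeriodVanishing (hn : 5 ≤ n) {f : CuspForm (Gamma1 N) (n + 2)}
    (hf : IsRePeriodVanishing n f) : f = 0 :=
  eq_zero_of_isRePeriodVanishing_of_span_eq_bot (span_rePeriodKerPlus_eq_bot hn)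
    (span_rePeriodKerMinus_eq_bot hn) hf

variable (N n) in
/-- **The Eichler–Shimura period lattice of `S_{n+2}(Γ₁(N))` spans the dual space over `ℝ`**
(`n ≥ 5`, i.e. weights `k ≥ 7`): a real-linear functional on `S^∨` is `φ ↦ re φ(f)` for some `f`
(reflexivity of the finite-dimensional `S`), and if it kills the period lattice then `f` has purely
imaginary periods, so `f = 0` (`eq_zero_of_isRePeriodVanishing`) — one half of Shimura's (3.5.20)
"discrete submodule of maximal rank" for `Γ' = Γ₁(N)` (Shimura 1971, Thm. 8.4). [cite: Shimura1971, Thm. 8.4 and (3.5.20)] -/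
theorem periodLatticeK1_span_real_eq_top (hn : 5 ≤ n) :
    Submodule.span ℝ (periodLatticeK1 (N := N) n : Set (Module.Dual ℂ (CuspForm (Gamma1 N) (n + 2)))) = ⊤ := by
  by_contra htop
  obtain ⟨ℓ, hℓ, hker⟩ := Submodule.exists_le_ker_of_lt_top _ (lt_top_iff_ne_top.mpr htop)
  let ψ : Module.Dual ℂ (Module.Dual ℂ (CuspForm (Gamma1 N) (n + 2))) := Module.Dual.extendRCLike ℓ
  have hψ : ∀ φ, (ψ φ).re = ℓ φ := fun φ ↦ Module.Dual.re_extendRCLike_apply (𝕜 := ℂ) ℓ φ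
  obtain ⟨f, hf⟩ := (Module.evalEquiv ℂ (CuspForm (Gamma1 N) (n + 2))).surjective ψ
  have hre : IsRePeriodVanishing n f := by
    intro φ hφ
    have h1 : ψ φ = φ f := by rw [← hf]; rfl
    rw [← h1, hψ]
    exact hker (Submodule.subset_span hφ)
  have h0 : f = 0 := eq_zero_of_isRePeriodVanishing hn hre
  apply hℓ
  ext φ
  rw [← hψ, ← hf, h0]
  simp

/-- **A full Hecke-stable lattice from `2 dim_ℂ S` generators of the period lattice**
(`HeckeStableRealLattice N (n + 2)` of `DeligneSerreProp27RealLatticeProofs`, `n ≥ 5`): if the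
Eichler–Shimura period lattice of `S_{n+2}(Γ₁(N))` is the `ℤ`-span of `2 dim_ℂ S_{n+2}(Γ₁(N))`
functionals — the rank half of Shimura's Thm. 8.4 (`dim_ℝ H¹_P = 2 dim_ℂ S_k`, from the Manin
presentation of the parabolic cohomology and the dimension formula) — then these functionals are an
`ℝ`-basis of the dual space (they span by `periodLatticeK1_span_real_eq_top`), and their `ℤ`-span is
stable under all `T_p^∨` and `⟨d⟩^∨` (`periodLatticeK1_fg_stable_separating`). [cite: Shimura1971, (3.5.20) and Thm. 8.4] -/
def heckeStableRealLatticeOfGenerators (hn : 5 ≤ n)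
    (g : Fin (2 * Module.finrank ℂ (CuspForm (Gamma1 N) (n + 2))) →
      Module.Dual ℂ (CuspForm (Gamma1 N) (n + 2)))
    (hg : (periodLatticeK1 (N := N) n : Set (Module.Dual ℂ (CuspForm (Gamma1 N) (n + 2)))) =
      Submodule.span ℤ (Set.range g)) :
    HeckeStableRealLattice N (n + 2) := by
  have hspan : ⊤ ≤ Submodule.span ℝ (Set.range g) := by
    rw [← periodLatticeK1_span_real_eq_top N n hn, Submodule.span_le, hg]
    exact Submodule.span_le_restrictScalars ℤ ℝ _
  have hcard : Fintype.card (Fin (2 * Module.finrank ℂ (CuspForm (Gamma1 N) (n + 2)))) =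
      Module.finrank ℝ (Module.Dual ℂ (CuspForm (Gamma1 N) (n + 2))) := by
    rw [Fintype.card_fin, finrank_real_of_complex, Subspace.dual_finrank_eq]
  have hli : LinearIndependent ℝ g := linearIndependent_of_top_le_span_of_card_eq_finrank hspan hcard
  have hlat : ∀ φ, φ ∈ periodLatticeK1 (N := N) n ↔ φ ∈ Submodule.span ℤ (Set.range g) := fun φ ↦ by
    rw [← SetLike.mem_coe, hg, SetLike.mem_coe]
  refine ⟨_, Module.Basis.mk hli hspan, fun p hp i ↦ ?_, fun d i ↦ ?_⟩
  · rw [Module.Basis.coe_mk, ← hlat]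
    exact (periodLatticeK1_fg_stable_separating N n).2.1 p hp _
      ((hlat _).mpr (Submodule.subset_span (Set.mem_range_self i)))
  · rw [Module.Basis.coe_mk, ← hlat]
    exact (periodLatticeK1_fg_stable_separating N n).2.2.1 _ _
      ((hlat _).mpr (Submodule.subset_span (Set.mem_range_self i)))

end Assembly

end Literature.NumberTheory.EllipticCurves.ModularForms
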